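import Literature.MathematicalPhysics.QuantumFieldTheory.U1CoulombSheet
import Literature.Analysis.FunctionSpaces.LatticeGreenKernel
import Literature.Analysis.FunctionSpaces.LatticeSegmentEnergy
import HarnessLib

/-!
# The Coulomb energy of a Wilson-loop sheet obeys a perimeter bound (`d ≥ 4`)

Assembly file (module "P4d", final part) of the lattice potential theory for the four-dimensional
`U(1)` gauge theory (proof programme of the named fact
`Literature.MathematicalPhysics.QuantumFieldTheory.FrohlichSpencerU1PerimeterLawD4`).
Fröhlich–Spencer 1982, §2.10 (2.88), use without proof ("by an easy estimation") that the
Coulomb 2-form `ε_Λ` of the sheet `S` of a rectangular `L × T` Wilson loop (the minimiser of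
`‖σ + c‖₂²` over 2-chains `c` closed in `Λ`, §2.7 (2.51)) satisfies `(ε_Λ, ε_Λ) ≤ const (L + T)`.
Here we prove the infinite-volume core of this estimate in every dimension `d = n + 1 ≥ 4`:

* `exists_testChain_sheet`: **there is a constant `C = C(n)` such that for every rectangle
  (`x₀`, plane `i ≠ j`, sides `R, T ≥ 1`) there is a finitely supported, totally alternating real
  3-chain `f` with `‖σ - ∂f‖₂² ≤ C (R + T)`**, `σ = sheetT x₀ i j R T`.

Since `∂f` is closed and supported in a finite box, `(ε_Λ, ε_Λ) ≤ ‖σ - ∂f‖₂² ≤ C (R+T)` for all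
boxes `Λ` containing the support (the glue to (2.88) is done downstream).

Proof (all ingredients are tree files of this programme): take `f = d₂ (p ∗ σ)` with the Green
kernel `p = greenKernel δ N` of `LatticeGreenKernel` (`‖μ p̂ - 1‖_{L²(T^d)} ≤ η`). By the Hodge
identity (`LatticeConvolution.sub_div₃_d₂_conv₂`) `σ - ∂f = A + B`, `A = σ - p ∗ (-Δσ)`,
`B = d₁ (p ∗ ∂σ)`, and `‖σ - ∂f‖² ≤ 2‖A‖² + 2‖B‖²`. In Fourier space (`LatticeChainFourierNorms`)
`Â_{kl} = (1 - p̂ μ) σ̂_{kl}` with `|σ̂_{kl}| ≤ R T`, so `‖A‖² ≤ ½ d² (RT)² η`; and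
`‖B‖² ≤ 2 ∫ μ p̂² ∑ₖ |Ĵₖ|²`, `J = ∂σ` the loop current, where pointwise
`μ p̂² ∑ₖ |Ĵₖ|² ≤ 2 (μp̂ - 1)² (RT)² + 2 (4|D_T(x_j)|² + 4|D_R(x_i)|²)/μ` (`U1CoulombSheet`: the
current is carried by the four sides), and `∫ |D_T(x_j)|²/μ ≤ T · C_n` by the Fubini bound of
`LatticeSegmentEnergy` with `C_n = ∫_{T^n} dθ/μ < ∞` (`n ≥ 3`) and `∫_T |D_T|² = T`
(`LatticeSegmentFourier`). Choosing `η = 1/((d²+8)(RT)² + 1)` gives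
`‖σ - ∂f‖² ≤ 32 C_n (R + T) + 1 ≤ (32 C_n + 1)(R + T)`.
Everything is proved; no named fact is introduced.

## References

* J. Fröhlich, T. Spencer, Comm. Math. Phys. 83 (1982) 411–454, §2.7 (2.50)–(2.52), §2.10 (2.86)–(2.88).
  [FrohlichSpencerCMP1982]
* A. H. Guth, Phys. Rev. D 21 (1980) 2291–2307 (the Coulomb-gas lower bound in `d = 4`). [Guth1980]
-/

noncomputable section

open MeasureTheory Finset Function Complex Literature.Probability.LatticeModels
open Literature.Analysis.FunctionSpaces
open Literature.Analysis.FunctionSpaces.LatticeFourier hiding e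
open Literature.Analysis.FunctionSpaces.Torus (scalarTruncate freqBall)
open scoped Real ENNReal

namespace Literature.MathematicalPhysics.QuantumFieldTheory

namespace LatticeChain

open LatticeForm (e d₁ d₂)

/-! ### Finite support of `-Δ` and `d₁` -/

section Support

variable {d : ℕ}

/-- `negLap₂` of a finitely supported 2-tensor is finitely supported. [folklore] -/
theorem hasFiniteSupport_negLap₂ {M : Site d → Fin d → Fin d → ℝ} (hM : HasFiniteSupport M) :
    HasFiniteSupport (negLap₂ M) := by
  have h : negLap₂ M = fun y => ∑ i : Fin d,
      ((M - fun y => M (y + e i)) + (M - fun y => M (y - e i))) y := by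
    funext y k l
    simp [negLap₂, Finset.sum_apply]
  rw [h]
  exact Function.HasFiniteSupport.sum (fun i =>
    (hM.sub (hasFiniteSupport_comp_add hM (e i))).add (hM.sub (hasFiniteSupport_comp_sub hM (e i))))
    Finset.univ

/-- `d₁` of a finitely supported 1-tensor is finitely supported. [folklore] -/
theorem hasFiniteSupport_d₁ {φ : Site d → Fin d → ℝ} (hφ : HasFiniteSupport φ) :
    HasFiniteSupport (d₁ φ) :=
  hasFiniteSupport_of_imp_add hφ fun y h0 h1 => by
    funext k l
    simp [LatticeForm.d₁, h0, h1 k, h1 l]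

end Support

/-! ### The transverse Green constant and the side integrals -/

section Sides

variable {n : ℕ}

/-- **The transverse Green constant** `C_n = ∫_{T^n} dθ/μ(θ)` (extended inverse; finite for
`n ≥ 3`, `lintegral_inv_latticeDispersion_lt_top`). [cite: FrohlichSpencerCMP1982, §2.5 (2.36)] -/
def greenConst (n : ℕ) : ℝ :=
  (∫⁻ x : UnitAddTorus (Fin n), (ENNReal.ofReal (latticeDispersion x))⁻¹).toReal

/-- `C_n ≥ 0`. [folklore] -/
theorem greenConst_nonneg (n : ℕ) : 0 ≤ greenConst n := ENNReal.toReal_nonneg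

/-- **The side integral**: `x ↦ |D_T(x_l)|²/μ(x)` is integrable on `T^{n+1}` and
`∫ |D_T(x_l)|²/μ ≤ T · C_n` (`n ≥ 3`). [folklore] -/
theorem integral_dirichlet_sq_mul_inv_le (hn : 3 ≤ n) (l : Fin (n + 1)) (T : ℕ) :
    Integrable (fun x : UnitAddTorus (Fin (n + 1)) =>
        ‖dirichletSum T (x l)‖ ^ 2 * (latticeDispersion x)⁻¹) volume ∧
      ∫ x : UnitAddTorus (Fin (n + 1)), ‖dirichletSum T (x l)‖ ^ 2 * (latticeDispersion x)⁻¹ ≤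
        T * greenConst n := by
  set f : UnitAddTorus (Fin (n + 1)) → ℝ := fun x =>
    ‖dirichletSum T (x l)‖ ^ 2 * (latticeDispersion x)⁻¹ with hf
  have hmeas : Measurable f :=
    (((continuous_dirichletSum T).comp (continuous_apply l)).norm.pow 2).measurable.mul
      continuous_latticeDispersion.measurable.inv
  have hnn : ∀ x, 0 ≤ f x := fun x =>
    mul_nonneg (sq_nonneg _) (inv_nonneg.2 (latticeDispersion_nonneg x))
  -- pointwise comparison with the extended-inverse integrand
  have hpt : ∀ x, ENNReal.ofReal (f x) ≤
      ‖dirichletSum T (x l)‖ₑ ^ 2 * (ENNReal.ofReal (latticeDispersion x))⁻¹ := by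
    intro x
    by_cases hμ : latticeDispersion x = 0
    · simp [hf, hμ]
    · have hpos : 0 < latticeDispersion x :=
        lt_of_le_of_ne (latticeDispersion_nonneg x) (Ne.symm hμ)
      rw [hf]
      simp only
      rw [ENNReal.ofReal_mul (sq_nonneg _), ENNReal.ofReal_inv_of_pos hpos,
        ENNReal.ofReal_pow (norm_nonneg _), ofReal_norm]
  have hφ : Measurable fun τ : UnitAddCircle => ‖dirichletSum T τ‖ₑ ^ 2 :=
    (continuous_dirichletSum T).measurable.enorm.pow_const 2
  have hlin : ∫⁻ x, ENNReal.ofReal (f x) ≤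
      (T : ℝ≥0∞) * ∫⁻ x : UnitAddTorus (Fin n), (ENNReal.ofReal (latticeDispersion x))⁻¹ :=
    calc ∫⁻ x, ENNReal.ofReal (f x)
        ≤ ∫⁻ x : UnitAddTorus (Fin (n + 1)),
            ‖dirichletSum T (x l)‖ₑ ^ 2 * (ENNReal.ofReal (latticeDispersion x))⁻¹ :=
          lintegral_mono hpt
      _ ≤ (∫⁻ τ : UnitAddCircle, ‖dirichletSum T τ‖ₑ ^ 2) *
            ∫⁻ x : UnitAddTorus (Fin n), (ENNReal.ofReal (latticeDispersion x))⁻¹ :=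
          lintegral_mul_inv_latticeDispersion_le l hφ
      _ = (T : ℝ≥0∞) * ∫⁻ x : UnitAddTorus (Fin n), (ENNReal.ofReal (latticeDispersion x))⁻¹ := by
          rw [lintegral_enorm_sq_dirichletSum T]
  have hC : ∫⁻ x : UnitAddTorus (Fin n), (ENNReal.ofReal (latticeDispersion x))⁻¹ < ∞ :=
    lintegral_inv_latticeDispersion_lt_top (by simpa using hn)
  have hfin : ∫⁻ x, ENNReal.ofReal (f x) < ∞ :=
    lt_of_le_of_lt hlin (ENNReal.mul_lt_top (by simp) hC)
  have hint : Integrable f volume := by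
    refine ⟨hmeas.aestronglyMeasurable, ?_⟩
    rw [hasFiniteIntegral_iff_ofReal (ae_of_all _ hnn)]
    exact hfin
  refine ⟨hint, ?_⟩
  rw [integral_eq_lintegral_of_nonneg_ae (ae_of_all _ hnn) hmeas.aestronglyMeasurable]
  have h := ENNReal.toReal_mono (ENNReal.mul_ne_top (by simp) hC.ne) hlin
  rwa [ENNReal.toReal_mul, ENNReal.toReal_natCast] at h

end Sides

/-! ### The main theorem -/

section Main

variable {n : ℕ}

/-- `Q² ≤ 2 (Q - 1)² + 2`. [folklore] -/
theorem sq_le_two_mul_sq_sub_one_add (Q : ℝ) : Q ^ 2 ≤ 2 * (Q - 1) ^ 2 + 2 := by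
  nlinarith [sq_nonneg (Q - 2)]

/-- **The key pointwise bound** for the `B`-term: with `Y = ∑ₖ |Ĵₖ|²` satisfying `Y ≤ μ (RT)²` and
`Y ≤ W`, `μ P² Y ≤ 2 (μP - 1)² (RT)² + 2 W μ⁻¹` (all `x`; for `μ = 0` both sides vanish or the
right side is `≥ 0`). [folklore] -/
theorem dispersion_mul_sq_mul_le {μ P Y W A : ℝ} (hμ : 0 ≤ μ) (hY : 0 ≤ Y) (hW : Y ≤ W)
    (hYμ : Y ≤ μ * A) (hAnn : 0 ≤ A) :
    μ * (P ^ 2 * Y) ≤ 2 * (μ * P - 1) ^ 2 * A + 2 * (W * μ⁻¹) := by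
  rcases hμ.eq_or_lt with h0 | hpos
  · rw [← h0]
    simp only [zero_mul, inv_zero, mul_zero, add_zero, zero_sub]
    positivity
  · have hYdiv : Y * μ⁻¹ ≤ A := by
      rw [← div_eq_mul_inv, div_le_iff₀ hpos]; linarith
    have hYdivW : Y * μ⁻¹ ≤ W * μ⁻¹ :=
      mul_le_mul_of_nonneg_right hW (inv_nonneg.2 hμ)
    have hYdivnn : 0 ≤ Y * μ⁻¹ := mul_nonneg hY (inv_nonneg.2 hμ)
    have hkey : μ * (P ^ 2 * Y) = (μ * P) ^ 2 * (Y * μ⁻¹) := by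
      field_simp
    rw [hkey]
    have hQ := sq_le_two_mul_sq_sub_one_add (μ * P)
    calc (μ * P) ^ 2 * (Y * μ⁻¹) ≤ (2 * (μ * P - 1) ^ 2 + 2) * (Y * μ⁻¹) :=
          mul_le_mul_of_nonneg_right hQ hYdivnn
      _ = 2 * (μ * P - 1) ^ 2 * (Y * μ⁻¹) + 2 * (Y * μ⁻¹) := by ring
      _ ≤ 2 * (μ * P - 1) ^ 2 * A + 2 * (W * μ⁻¹) :=
          add_le_add (mul_le_mul_of_nonneg_left hYdiv (by positivity))
            (mul_le_mul_of_nonneg_left hYdivW (by norm_num))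

/-- **The Coulomb energy of a Wilson-loop sheet obeys a perimeter bound** (`d = n + 1`, `n ≥ 3`):
there is `C = C(n) > 0` such that for every rectangle — base point `x₀`, coordinate plane `(i, j)`
with `i ≠ j`, sides `R, T ≥ 1` — some finitely supported totally alternating real 3-chain `f` has
`⟪σ - ∂f, σ - ∂f⟫₂ ≤ C (R + T)`, `σ = sheetT x₀ i j R T`. This is the estimate
`(ε_Λ, ε_Λ) ≤ const (L + T)` used in Fröhlich–Spencer (2.88) (there for `d = 4`), in the
variational form `(ε_Λ, ε_Λ) = min_{c closed in Λ} ‖σ + c‖² ≤ ‖σ - ∂f‖²`. [cite: FrohlichSpencerCMP1982, §2.10 (2.88)] -/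
theorem exists_testChain_sheet (hn : 3 ≤ n) :
    ∃ C : ℝ, 0 < C ∧ ∀ (x₀ : Site (n + 1)) (i j : Fin (n + 1)), i ≠ j → ∀ R T : ℕ, 1 ≤ R → 1 ≤ T →
      ∃ f : Site (n + 1) → Fin (n + 1) → Fin (n + 1) → Fin (n + 1) → ℝ,
        HasFiniteSupport f ∧ IsAltR₃ f ∧
          pair₂ (sheetT x₀ i j R T - div₃ f) (sheetT x₀ i j R T - div₃ f) ≤ C * (R + T) := by
  refine ⟨32 * greenConst n + 1, by positivity [greenConst_nonneg n], ?_⟩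
  intro x₀ i j hij R T hR hT
  -- the sheet
  set σ := sheetT x₀ i j R T with hσ
  have hσfs : HasFiniteSupport σ := hasFiniteSupport_sheetT x₀ i j R T
  -- accuracy `η` of the Green kernel
  set A0 : ℝ := (((n : ℝ) + 1) ^ 2 + 8) * (((R : ℝ) * T) ^ 2) with hA0
  have hA0nn : 0 ≤ A0 := by positivity
  set η : ℝ := 1 / (A0 + 1) with hη
  have hηpos : 0 < η := by positivity
  have hηA : A0 * η ≤ 1 := by
    rw [hη, mul_one_div, div_le_one (by positivity)]; linarith
  obtain ⟨δ, hδ, N, hN⟩ := exists_greenKernel (d := n + 1) (by omega) hηpos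
  set p : Site (n + 1) → ℝ := greenKernel δ N with hp
  set S : Finset (Site (n + 1)) := freqBall N with hS
  set Pr : UnitAddTorus (Fin (n + 1)) → ℝ := scalarTruncate N (truncInv δ) with hPr
  have hP : ∀ x, latFT S p x = ((Pr x : ℝ) : ℂ) := fun x => latFT_greenKernel hδ N x
  have hPrc : Continuous Pr := Torus.continuous_scalarTruncate N _
  -- the test chain `f = d₂ (p ∗ σ)` and the error decomposition `σ - ∂f = A + B`
  refine ⟨d₂ (conv₂ S p σ), hasFiniteSupport_d₂ (hasFiniteSupport_conv₂ S p hσfs),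
    isAltR₃_d₂ (isAltR₂_conv₂ S p (isAltR₂_sheetT x₀ hij R T)), ?_⟩
  set A := σ - conv₂ S p (negLap₂ σ) with hA
  set B := d₁ (conv₁ S p (div₂ σ)) with hB
  have hJfs : HasFiniteSupport (div₂ σ) := hasFiniteSupport_div₂_sheetT x₀ i j R T
  have hφfs : HasFiniteSupport (conv₁ S p (div₂ σ)) := hasFiniteSupport_conv₁ S p hJfs
  have hAfs : HasFiniteSupport A :=
    hσfs.sub (hasFiniteSupport_conv₂ S p (hasFiniteSupport_negLap₂ hσfs))
  have hBfs : HasFiniteSupport B := hasFiniteSupport_d₁ hφfs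
  rw [sub_div₃_d₂_conv₂ S p σ]
  change pair₂ (A + B) (A + B) ≤ _
  have hE := pair₂_add_self_le hAfs hBfs
  /- ‖A‖² ≤ ½ (n+1)² (RT)² η -/
  have hAA : pair₂ A A ≤ (1 / 2) * (((n : ℝ) + 1) ^ 2 * ((((R : ℝ) * T) ^ 2) * η)) := by
    rw [pair₂_self_eq_integral hAfs]
    refine mul_le_mul_of_nonneg_left ?_ (by norm_num)
    -- each component
    have hcomp : ∀ k l, ∫ x, ‖latF (fun y => A y k l) x‖ ^ 2 ≤ (((R : ℝ) * T) ^ 2) * η := by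
      intro k l
      have hskl : HasFiniteSupport fun y => σ y k l := hasFiniteSupport_component₂ hσfs k l
      have hfun : (fun y => A y k l) = (fun y => σ y k l) - conv S p (negLap₀ fun y => σ y k l) := by
        funext y; rfl
      have hval : ∀ x, latF (fun y => A y k l) x =
          (1 - ((Pr x : ℝ) : ℂ) * ((latticeDispersion x : ℝ) : ℂ)) *
            ((coef i j k l : ℂ) * latF (rectInd x₀ i j R T) x) := by
        intro x
        rw [hfun, latF_sub_conv_negLap₀ S p hskl x, hP x]
        congr 1
        exact latF_const_mul (coef i j k l) (hasFiniteSupport_rectInd x₀ i j R T) x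
      have hpt : ∀ x, ‖latF (fun y => A y k l) x‖ ^ 2 ≤
          (((R : ℝ) * T) ^ 2) * (latticeDispersion x * Pr x - 1) ^ 2 := by
        intro x
        rw [hval x, norm_mul, norm_mul, mul_pow, mul_pow]
        have h1 : ‖(1 : ℂ) - ((Pr x : ℝ) : ℂ) * ((latticeDispersion x : ℝ) : ℂ)‖ ^ 2 =
            (latticeDispersion x * Pr x - 1) ^ 2 := by
          have : (1 : ℂ) - ((Pr x : ℝ) : ℂ) * ((latticeDispersion x : ℝ) : ℂ) =
              ((1 - Pr x * latticeDispersion x : ℝ) : ℂ) := by push_cast; ring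
          rw [this, Complex.norm_real, Real.norm_eq_abs, sq_abs]; ring
        have h2 : ‖(coef i j k l : ℂ)‖ ^ 2 ≤ 1 := by
          rw [Complex.norm_real, Real.norm_eq_abs]
          have := abs_coef_le i j k l
          nlinarith [abs_nonneg (coef i j k l)]
        have h3 : ‖latF (rectInd x₀ i j R T) x‖ ^ 2 ≤ ((R : ℝ) * T) ^ 2 :=
          pow_le_pow_left₀ (norm_nonneg _) (norm_latF_rectInd_le x₀ i j R T x) 2
        rw [h1]
        have h4 : ‖(coef i j k l : ℂ)‖ ^ 2 * ‖latF (rectInd x₀ i j R T) x‖ ^ 2 ≤ ((R : ℝ) * T) ^ 2 := by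
          calc ‖(coef i j k l : ℂ)‖ ^ 2 * ‖latF (rectInd x₀ i j R T) x‖ ^ 2
              ≤ 1 * ((R : ℝ) * T) ^ 2 := mul_le_mul h2 h3 (sq_nonneg _) (by norm_num)
            _ = ((R : ℝ) * T) ^ 2 := one_mul _
        nlinarith [sq_nonneg (latticeDispersion x * Pr x - 1)]
      have hi1 : Integrable (fun x => ‖latF (fun y => A y k l) x‖ ^ 2) volume :=
        ((continuous_norm.comp (continuous_latF (hasFiniteSupport_component₂ hAfs k l))).pow 2).integrable_unitAddTorus
      have hi2 : Integrable (fun x => (((R : ℝ) * T) ^ 2) * (latticeDispersion x * Pr x - 1) ^ 2) volume :=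
        ((((continuous_latticeDispersion.mul hPrc).sub continuous_const).pow 2).integrable_unitAddTorus).const_mul _
      calc ∫ x, ‖latF (fun y => A y k l) x‖ ^ 2
          ≤ ∫ x, (((R : ℝ) * T) ^ 2) * (latticeDispersion x * Pr x - 1) ^ 2 := integral_mono hi1 hi2 hpt
        _ = (((R : ℝ) * T) ^ 2) * ∫ x, (latticeDispersion x * Pr x - 1) ^ 2 := integral_const_mul _ _
        _ ≤ (((R : ℝ) * T) ^ 2) * η := mul_le_mul_of_nonneg_left hN (sq_nonneg _)
    calc ∑ k, ∑ l, ∫ x, ‖latF (fun y => A y k l) x‖ ^ 2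
        ≤ ∑ k : Fin (n + 1), ∑ l : Fin (n + 1), (((R : ℝ) * T) ^ 2) * η :=
          Finset.sum_le_sum fun k _ => Finset.sum_le_sum fun l _ => hcomp k l
      _ = ((n : ℝ) + 1) ^ 2 * ((((R : ℝ) * T) ^ 2) * η) := by
          simp only [Finset.sum_const, Finset.card_univ, Fintype.card_fin, nsmul_eq_mul]
          push_cast; ring
  /- ‖B‖² ≤ 4 (RT)² η + 16 (T + R) C_n -/
  have hBB : pair₂ B B ≤ 4 * (((R : ℝ) * T) ^ 2) * η + 16 * ((T : ℝ) + R) * greenConst n := by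
    have h0 := pair₂_d₁_self_le hφfs
    -- the integrand `μ ∑ₖ |φ̂ₖ|² = μ P² Y`
    set Y : UnitAddTorus (Fin (n + 1)) → ℝ := fun x =>
      ∑ k, ‖latF (fun y => div₂ σ y k) x‖ ^ 2 with hY
    have hφk : ∀ k x, latF (fun y => conv₁ S p (div₂ σ) y k) x =
        ((Pr x : ℝ) : ℂ) * latF (fun y => div₂ σ y k) x := by
      intro k x
      have : (fun y => conv₁ S p (div₂ σ) y k) = conv S p fun y => div₂ σ y k := rfl
      rw [this, latF_conv S p (hasFiniteSupport_component₁ hJfs k) x, hP x]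
    have hintegrand : ∀ x, latticeDispersion x * ∑ k, ‖latF (fun y => conv₁ S p (div₂ σ) y k) x‖ ^ 2 =
        latticeDispersion x * (Pr x ^ 2 * Y x) := by
      intro x
      congr 1
      simp only [hφk, norm_mul, mul_pow, Complex.norm_real, Real.norm_eq_abs, sq_abs, hY, Finset.mul_sum]
    -- the side functions
    set W : UnitAddTorus (Fin (n + 1)) → ℝ := fun x =>
      4 * ‖dirichletSum T (x j)‖ ^ 2 + 4 * ‖dirichletSum R (x i)‖ ^ 2 with hW
    have hYW : ∀ x, Y x ≤ W x := fun x => sum_norm_sq_latF_div₂_sheetT_le x₀ hij R T x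
    have hYμ : ∀ x, Y x ≤ latticeDispersion x * (((R : ℝ) * T) ^ 2) := fun x =>
      sum_norm_sq_latF_div₂_sheetT_le_dispersion x₀ hij R T x
    have hYnn : ∀ x, 0 ≤ Y x := fun x => Finset.sum_nonneg fun k _ => sq_nonneg _
    have hpt : ∀ x, latticeDispersion x * (Pr x ^ 2 * Y x) ≤
        2 * (latticeDispersion x * Pr x - 1) ^ 2 * (((R : ℝ) * T) ^ 2) + 2 * (W x * (latticeDispersion x)⁻¹) :=
      fun x => dispersion_mul_sq_mul_le (latticeDispersion_nonneg x) (hYnn x) (hYW x) (hYμ x) (sq_nonneg _)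
    -- integrability
    obtain ⟨hIj, hIj'⟩ := integral_dirichlet_sq_mul_inv_le hn j T
    obtain ⟨hIi, hIi'⟩ := integral_dirichlet_sq_mul_inv_le hn i R
    have hWint : Integrable (fun x => W x * (latticeDispersion x)⁻¹) volume := by
      have : (fun x => W x * (latticeDispersion x)⁻¹) = fun x =>
          4 * (‖dirichletSum T (x j)‖ ^ 2 * (latticeDispersion x)⁻¹) +
            4 * (‖dirichletSum R (x i)‖ ^ 2 * (latticeDispersion x)⁻¹) := by
        funext x; simp only [hW]; ring
      rw [this]
      exact (hIj.const_mul 4).add (hIi.const_mul 4)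
    have hWval : ∫ x, W x * (latticeDispersion x)⁻¹ ≤ 4 * ((T : ℝ) + R) * greenConst n := by
      have : (fun x => W x * (latticeDispersion x)⁻¹) = fun x =>
          4 * (‖dirichletSum T (x j)‖ ^ 2 * (latticeDispersion x)⁻¹) +
            4 * (‖dirichletSum R (x i)‖ ^ 2 * (latticeDispersion x)⁻¹) := by
        funext x; simp only [hW]; ring
      rw [this, integral_add (hIj.const_mul 4) (hIi.const_mul 4), integral_const_mul, integral_const_mul]
      nlinarith [hIj', hIi', greenConst_nonneg n]
    have hμc : Continuous (latticeDispersion (ι := Fin (n + 1))) := continuous_latticeDispersion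
    have hLint : Integrable (fun x => latticeDispersion x * (Pr x ^ 2 * Y x)) volume := by
      have hYc : Continuous Y := by
        rw [hY]
        refine continuous_finsetSum _ fun k _ => ?_
        exact (continuous_norm.comp (continuous_latF (hasFiniteSupport_component₁ hJfs k))).pow 2
      have hc : Continuous fun x => latticeDispersion x * (Pr x ^ 2 * Y x) := by fun_prop
      exact hc.integrable_unitAddTorus
    have hI1 : Integrable (fun x : UnitAddTorus (Fin (n + 1)) =>
        2 * (latticeDispersion x * Pr x - 1) ^ 2 * (((R : ℝ) * T) ^ 2)) volume := by
      have hc : Continuous fun x : UnitAddTorus (Fin (n + 1)) =>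
          2 * (latticeDispersion x * Pr x - 1) ^ 2 * (((R : ℝ) * T) ^ 2) := by fun_prop
      exact hc.integrable_unitAddTorus
    have hI2 : Integrable (fun x : UnitAddTorus (Fin (n + 1)) =>
        2 * (W x * (latticeDispersion x)⁻¹)) volume := hWint.const_mul 2
    have hI0 : Integrable (fun x : UnitAddTorus (Fin (n + 1)) =>
        (latticeDispersion x * Pr x - 1) ^ 2) volume := by
      have hc : Continuous fun x : UnitAddTorus (Fin (n + 1)) =>
          (latticeDispersion x * Pr x - 1) ^ 2 := by fun_prop
      exact hc.integrable_unitAddTorus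
    have hI12 : Integrable (fun x : UnitAddTorus (Fin (n + 1)) =>
        2 * (latticeDispersion x * Pr x - 1) ^ 2 * (((R : ℝ) * T) ^ 2) +
          2 * (W x * (latticeDispersion x)⁻¹)) volume := hI1.add hI2
    have hmono := integral_mono hLint hI12 hpt
    have hRHS : ∫ x : UnitAddTorus (Fin (n + 1)),
        (2 * (latticeDispersion x * Pr x - 1) ^ 2 * (((R : ℝ) * T) ^ 2) + 2 * (W x * (latticeDispersion x)⁻¹)) =
        2 * (∫ x : UnitAddTorus (Fin (n + 1)), (latticeDispersion x * Pr x - 1) ^ 2) * (((R : ℝ) * T) ^ 2) +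
          2 * ∫ x : UnitAddTorus (Fin (n + 1)), W x * (latticeDispersion x)⁻¹ := by
      rw [integral_add hI1 hI2, integral_mul_const, integral_const_mul, integral_const_mul]
    rw [hRHS] at hmono
    simp_rw [hintegrand] at h0
    nlinarith [hmono, hN, hWval, sq_nonneg ((R : ℝ) * T), greenConst_nonneg n, h0]
  /- conclusion -/
  have hRT : (2 : ℝ) ≤ (R : ℝ) + T := by
    have h1 : (1 : ℝ) ≤ R := by exact_mod_cast hR
    have h2 : (1 : ℝ) ≤ T := by exact_mod_cast hT
    linarith
  have hCn := greenConst_nonneg n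
  calc pair₂ (A + B) (A + B) ≤ 2 * pair₂ A A + 2 * pair₂ B B := hE
    _ ≤ A0 * η + 32 * greenConst n * ((R : ℝ) + T) := by
        rw [hA0]; nlinarith [hAA, hBB]
    _ ≤ 1 + 32 * greenConst n * ((R : ℝ) + T) := by linarith
    _ ≤ (32 * greenConst n + 1) * ((R : ℝ) + T) := by nlinarith

/-- `div₃` of a totally alternating 3-tensor is alternating. [folklore] -/
theorem isAltR₂_div₃ {d : ℕ} {f : Site d → Fin d → Fin d → Fin d → ℝ} (hf : IsAltR₃ f) :
    IsAltR₂ (div₃ f) := fun y k l => by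
  simp only [div₃, hf.2 _ _ k l, ← Finset.sum_neg_distrib]
  refine Finset.sum_congr rfl fun j _ => ?_
  ring

/-- `div₂` is odd. [folklore] -/
theorem div₂_neg {d : ℕ} (M : Site d → Fin d → Fin d → ℝ) : div₂ (-M) = -div₂ M := by
  funext y k
  simp only [div₂, Pi.neg_apply, ← Finset.sum_neg_distrib]
  refine Finset.sum_congr rfl fun j _ => ?_
  ring

/-- **Corollary (closed-chain form).** With the same constant: for every rectangle there is a
finitely supported, alternating, *closed* real 2-chain `c` (`∂c = 0`) with `⟪σ + c, σ + c⟫₂ ≤ C (R + T)`;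
hence the minimal Coulomb energy `(ε_Λ, ε_Λ) = min {‖σ + c‖² : c closed in Λ}` of Fröhlich–Spencer
(2.51) is `≤ C (R + T)` for every box `Λ` containing the support of `c`. [cite: FrohlichSpencerCMP1982, §2.7 (2.51), §2.10 (2.88)] -/
theorem exists_closedChain_sheet (hn : 3 ≤ n) :
    ∃ C : ℝ, 0 < C ∧ ∀ (x₀ : Site (n + 1)) (i j : Fin (n + 1)), i ≠ j → ∀ R T : ℕ, 1 ≤ R → 1 ≤ T →
      ∃ c : Site (n + 1) → Fin (n + 1) → Fin (n + 1) → ℝ,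
        HasFiniteSupport c ∧ IsAltR₂ c ∧ div₂ c = 0 ∧
          pair₂ (sheetT x₀ i j R T + c) (sheetT x₀ i j R T + c) ≤ C * (R + T) := by
  obtain ⟨C, hC, h⟩ := exists_testChain_sheet hn
  refine ⟨C, hC, fun x₀ i j hij R T hR hT => ?_⟩
  obtain ⟨f, hfs, halt, hle⟩ := h x₀ i j hij R T hR hT
  refine ⟨-div₃ f, (hasFiniteSupport_div₃ hfs).neg, fun y k l => ?_, ?_, ?_⟩
  · simp only [Pi.neg_apply, isAltR₂_div₃ halt y k l, neg_neg]
  · rw [div₂_neg, div₂_div₃ halt.1, neg_zero]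
  · simpa [sub_eq_add_neg] using hle

end Main

end LatticeChain

end Literature.MathematicalPhysics.QuantumFieldTheory
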